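import Summits.Ventures.QEC.Census.CertCoverBatch
import Summits.Ventures.QEC.Census.BB.A1s_n192_k4_0fa3ae82.CoreDefs
import HarnessLib

set_option Elab.async false
set_option maxRecDepth 200000

/-!
# `[[192,4,18]]` one-level cover certificate — LEVEL-1→0 coset problems 31…40 (problem 1 excluded: `Prob1.lean`) as COMPACT data
(`ProbData`: U, f, σ, y₀, allow; qec-type-10 `CertCoverBatch.mkCoset` rebuilds each `CosetProb` in the kernel) + their verdict
`probsOK cov covR hx hx1 D1 lxd 16` (one `decide +kernel`). qec-search-9 g5 (lead block 170 (0)(c)); data from JSON `level10.problems`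
(sha256 08367568…). Data + decided check; KERNEL.
-/

namespace Summit.Ventures.QEC.Census.A1s_n192_k4_0fa3ae82

open Matrix Summit.Ventures.QEC.Census Literature.InformationTheory.QuantumCodes

/-- Problems 31…40 (10): `⟨U, f, σ, y₀, allow⟩`. -/
def probs00d : List ProbData := [
    ⟨11619569342527800320, 1, 0, 0, [0, 36028797018963968, 4611686018427387904]⟩,
    ⟨11692189895109020672, 0, 0, 0, [0]⟩,
    ⟨13907397678351942656, 3, 0, 0, [0, 36028797018963968]⟩,
    ⟨13980018230933294080, 1, 0, 0, [0, 36028797018963968, 72057594037927936]⟩,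
    ⟨14125259336095734784, 0, 0, 0, [0]⟩,
    ⟨14340869159666095104, 1, 0, 0, [0, 131072, 36028797018963968]⟩,
    ⟨14774340640980771840, 0, 0, 0, [0]⟩,
    ⟨15641283603609601024, 0, 0, 0, [0]⟩,
    ⟨17375169528867193856, 1, 0, 0, [0, 32768, 36028797018963968]⟩,
    ⟨18519085350371526921, 2, 2199032233984, 72062017922603539, [562949953421312, 144115188075855872, 36893488147419103232]⟩]

set_option maxHeartbeats 400000000 in
/-- Every problem of this chunk passes (`mkCoset` elimination + `cosetOKD` + fast `σ` + depth + `BU`-evenness + label checks). -/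
theorem probs00d_ok : probsOK cov covR hx hx1 D1 lxd 16 probs00d = true := by
  decide +kernel

/-- Pointwise form. -/
theorem probs00d_all : ∀ x ∈ probs00d, probOK cov covR hx hx1 D1 lxd 16 x = true := by
  have h := probs00d_ok
  rwa [probsOK, List.all_eq_true] at h

end Summit.Ventures.QEC.Census.A1s_n192_k4_0fa3ae82
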